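import Summits.BirchSwinnertonDyer.Rank1Residual.ManinAdditive.ShimuraLedger
import Literature.NumberTheory.EllipticCurves.KatoAdditiveTwistedValueNeronIntegralitySymbolClosure
import HarnessLib
import HarnessLib.Audit.Tags

/-!
# THE THREE OPEN LAWS OF C2's SKELETON OF RECORD `kato_shift_two` v20, NAMED (cell `bsd-f2-manin`; C2 LEAD p1 g13 ask T-p1-g13-1; typer g18;
# nothing asserted)

TYPER NOTE (typer g18, T-p1-g13-1).  SOURCE = `Summits/BirchSwinnertonDyer/BirchSwinnertonDyer/Cruxes/ManinOddAtFour/Lines/kato_shift_two.lean` v20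
(crux-written commit 23f6d2176df8) = HOME/p1/g13/Line-kato-shift-two-v20.lean sha16 11ad92870c2f8504: the statements of its three INLINE law stubs
`stub_cuspidalKummerRepresentativeAtSixteenCore` (6a‴), `stub_cuspidalKummerOddExponentAtSixteenCore` (6b‴),
`stub_katoNeronIntegralTwoGamma1OptimalAtSixteenBlindCoreRecut` (6♭‴) copied VERBATIM (token for token, between `:` and `:= by`) as the bodies of three
`@[conjecture] def`s under the names the LEAD proposed, so that v21 can cite them BY NAME (the defs unfold definitionally to the inline texts; the
composition `maninOddAtFour_of_katoFact_of_levelSixteenCoreLaws_blindPeriodRecut` is unchanged).  PROVENANCE of the bodies: 6a‴ = an's E-an-48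
`CuspidalKummer.CuspidalKummerRepresentativeAtFour` body with `4 ∣ N ↦ 2⁴ ∣ N` and the two CORE binders added (p2 g14: `v₂(j(W)) < 1` i.e.
potentially supersingular at 2, and «no dyadic twist `W ⊗ d`, `d ∈ {−1, 2, −2}`, is 2-semistable»); 6b‴ = an's E-an-53 `CuspidalKummerOddExponent` body,
same three changes; 6♭‴ = es's E-es-110 body (Kato–Néron integrality `KatoFactTwoAt V D₁.f` at the `X₁(N)`-optimal curve) restricted to `16 ∣ N`,
OFF the period-dominated locus, on TOTALLY BLIND core classes.  Imports: the route-independent leaves `ShimuraLedger` (⟶ `CuspidalKummerClass`) and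
Literature `KatoAdditiveTwistedValueNeronIntegralitySymbolClosure` — ROUTE-INDEPENDENT (no Theses/Cruxes import); no Literature fact created.

HONEST FRAMING.  LENS: the LEAD's assembly (an's cuspidal-Kummer lens for 6a‴/6b‴, es's Kato–Néron lens for 6♭‴).  STATUS: all three are OPEN
laws — they ARE the open content of C2 (`ManinOddAtFour`) after v20 (LEAD 07:41Z): E-an-48/53 read on {16 ∣ N} ∩ core at data with a NON-blind
rational 2-torsion point (BC5: an ENGINE 2 / §77.4 census H1F2-4N-v1-ord2j.tsv fecc4f89a5142e36 — 16 ∣ N ≤ 944: 237/237 rational-T rows, stratum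
190/190 with a plain η-quotient representative with an odd exponent, 0 counterexamples; E-an-48 384/384, E-an-53 367/367 at all 4 ∣ N), and
Kato–Néron integrality at the X₁-optimal curve of totally blind core classes off the period-dominated locus (in Cremona's range: exactly the optimal
X₁(32)-datum of 32a — es §41: paper THEOREM 41.15 there, audit R-es-60 PASS modulo G0).  REFUTER VERDICTS on these exact texts: PENDING (the
un-cored bodies E-an-48/53, E-es-110 SURVIVE: ref1 §R1xx series).  The LEAD's condition «if an/es agree» (A-p1-g13-1) is recorded: this file names
the v20 texts as they stand; if an/es re-cut the binders, v21's stubs get NEW names here (append-only).  PARTITION currency: 0 (naming only);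
beyond-print theorem: NO; bears_on: stmt-BirchSwinnertonDyer-22967 (C2).  BSD is not proved by this; Manin's conjecture is not proved; C2/C3 OPEN.
-/

open scoped Classical MatrixGroups ModularForm NumberField
open IsDedekindDomain IsDedekindDomain.HeightOneSpectrum Rat.HeightOneSpectrum
open PowerSeries CongruenceSubgroup WeierstrassCurve Literature.NumberTheory.EllipticCurves
  Literature.NumberTheory.EllipticCurves.ModularForms
  Summit.BirchSwinnertonDyer.Rank1Residual.ManinAdditive
  Summit.BirchSwinnertonDyer.Rank1Residual.ManinAdditive.CuspidalKummer
  Summit.BirchSwinnertonDyer.Rank1Residual.ManinAdditive.ShimuraLedger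

namespace Summit.BirchSwinnertonDyer.Rank1Residual.ManinAdditive.CuspidalKummer

/-- **Law 6a‴ `CuspidalKummerRepresentativeOnCore`** (= v20 `stub_cuspidalKummerRepresentativeAtSixteenCore`, VERBATIM): K_geo = E-an-48 READ ON
THE CORE AT `16 ∣ N` — every rational 2-torsion point of an `X₀(N)`-optimal CORE curve (`16 ∣ N`, potentially supersingular at 2, no 2-semistable dyadic
twist) has a cuspidal Kummer representative.  OPEN, c-free; consumed only where a NON-blind point exists.  Why it might fail: a level `16 ∣ N`
beyond ENGINE 2's range whose rational-2-torsion Kummer class needs generalized Dedekind η-functions (none ≤ 944). -/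
@[conjecture]
def CuspidalKummerRepresentativeOnCore : Prop :=
  ∀ (W : WeierstrassCurve ℚ) [W.IsElliptic] [W.IsGloballyMinimal] {N : ℕ} [NeZero N]
    (D : ModularParametrizationData W N) (a : ℕ → ℤ), (∀ n, (a n : ℂ) = cuspCoeff D.f n) →
    2 ^ 4 ∣ N → (∀ z ∈ D.L.lattice, ∃ w ∈ periodLattice D.f, z = D.c * w) →
    ((primesEquiv (R := 𝓞 ℚ)).symm ⟨2, Nat.prime_two⟩).valuation ℚ W.j < 1 →
    (∀ d : ℤ, d = -1 ∨ d = 2 ∨ d = -2 → 2 ≤ (W.quadraticTwist (d : ℚ)).conductorExponent ((primesEquiv (R := ℤ)).symm ⟨2, Nat.prime_two⟩)) →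
    ∀ e : ℚ, W.twoTorsionPolynomial.toPoly.IsRoot e →
    ∀ z : ℚ⟦X⟧, IsParamGerm W D.c a z →
    ∃ (r : ℕ → ℤ) (g A B : ℤ⟦X⟧), IsCuspidalKummerRep N (kummerSeries W D.c e z) r g A B

/-- **Law 6b‴ `CuspidalKummerOddExponentOnCore`** (= v20 `stub_cuspidalKummerOddExponentAtSixteenCore`, VERBATIM): E-an-53 READ ON THE CORE AT
`16 ∣ N` — a NON-blind rational 2-torsion point has an odd `η`-exponent in every cuspidal Kummer representative.  OPEN, c-free.  Why it might fail: a
non-blind point whose Kummer class is an η-SQUARE class (none in range: 367/367). -/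
@[conjecture]
def CuspidalKummerOddExponentOnCore : Prop :=
  ∀ (W : WeierstrassCurve ℚ) [W.IsElliptic] [W.IsGloballyMinimal] {N : ℕ} [NeZero N]
    (D : ModularParametrizationData W N) (a : ℕ → ℤ), (∀ n, (a n : ℂ) = cuspCoeff D.f n) →
    2 ^ 4 ∣ N → (∀ z ∈ D.L.lattice, ∃ w ∈ periodLattice D.f, z = D.c * w) →
    ((primesEquiv (R := 𝓞 ℚ)).symm ⟨2, Nat.prime_two⟩).valuation ℚ W.j < 1 →
    (∀ d : ℤ, d = -1 ∨ d = 2 ∨ d = -2 → 2 ≤ (W.quadraticTwist (d : ℚ)).conductorExponent ((primesEquiv (R := ℤ)).symm ⟨2, Nat.prime_two⟩)) →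
    ∀ (a₂ a₄ e : ℤ), W.a₁ = 0 → W.a₃ = 0 → W.a₂ = a₂ → W.a₄ = a₄ →
    W.twoTorsionPolynomial.toPoly.IsRoot (e : ℚ) → ¬ KummerBlindAtTwo a₂ a₄ e →
    ∀ z : ℚ⟦X⟧, IsParamGerm W D.c a z →
    ∀ (r : ℕ → ℤ) (g A B : ℤ⟦X⟧), IsCuspidalKummerRep N (kummerSeries W D.c ((e : ℚ)) z) r g A B →
    ∃ δ ∈ N.divisors, Odd (r δ)

end Summit.BirchSwinnertonDyer.Rank1Residual.ManinAdditive.CuspidalKummer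

namespace Summit.BirchSwinnertonDyer.Rank1Residual.ManinAdditive.KatoCurve

/-- **Law 6♭‴ `KatoNeronIntegralTwoGamma1OptimalOnBlindCore`** (= v20 `stub_katoNeronIntegralTwoGamma1OptimalAtSixteenBlindCoreRecut`, VERBATIM):
E-es-110 READ ON {`16 ∣ N`} ∩ {off period-dominated} ∩ {TOTALLY BLIND CORE class}: Kato–Néron integrality `KatoFactTwoAt V D₁.f` at every
`X₁(N)`-OPTIMAL `V` with `16 ∣ N` such that (i) no globally minimal symbol-closure curve of the class satisfies `q·Ω(V′) = m·Ω(V)` with `q` odd, and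
(ii) the class contains a lattice-optimal, globally minimal, `a₁ = a₃ = 0`, TOTALLY BLIND `X₀(N)`-datum whose curve is potentially supersingular at
`2` and has no `2`-semistable dyadic twist.  OPEN law (the 2-part of Stevens' `c₁ = ±1` there, in Kato clothing); in-range content = {the optimal
X₁(32)-datum of 32a} (es §41, THEOREM 41.15 on paper).  Why it might fail: a blind core class beyond range where the X₁-optimal curve is not Kato's
curve and no odd period relation reaches it. -/
@[conjecture]
def KatoNeronIntegralTwoGamma1OptimalOnBlindCore : Prop :=
  ∀ (V : WeierstrassCurve ℚ) [V.IsElliptic] [V.IsGloballyMinimal] {N : ℕ} [NeZero N]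
    (D₁ : Gamma1ParametrizationData V N), D₁.IsOptimal → 2 ^ 4 ∣ N →
    (¬ ∃ (V' : WeierstrassCurve ℚ) (_ : V'.IsElliptic) (_ : V'.IsGloballyMinimal) (q m : ℤ),
      Odd q ∧ WeierstrassCurve.IsIsogenous V' V ∧ (q : ℝ) * V'.realPeriodRat = (m : ℝ) * V.realPeriodRat ∧
      IsSymbolClosureCurve V' D₁.f) →
    (∃ (W₀ : WeierstrassCurve ℚ) (_ : W₀.IsElliptic) (_ : W₀.IsGloballyMinimal) (D₀ : ModularParametrizationData W₀ N),
      IsIsogenous V W₀ ∧ (∀ z ∈ D₀.L.lattice, ∃ w ∈ periodLattice D₀.f, z = D₀.c * w) ∧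
      W₀.a₁ = 0 ∧ W₀.a₃ = 0 ∧ HasRationalTwoTorsion W₀ ∧ AllRationalTwoTorsionBlind W₀ ∧
      ((primesEquiv (R := 𝓞 ℚ)).symm ⟨2, Nat.prime_two⟩).valuation ℚ W₀.j < 1 ∧
      (∀ d : ℤ, d = -1 ∨ d = 2 ∨ d = -2 → 2 ≤ (W₀.quadraticTwist (d : ℚ)).conductorExponent ((primesEquiv (R := ℤ)).symm ⟨2, Nat.prime_two⟩))) →
    KatoFactTwoAt V D₁.f

end Summit.BirchSwinnertonDyer.Rank1Residual.ManinAdditive.KatoCurve
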